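import Literature.MathematicalPhysics.QuantumLattice.LatticeGaugeDLR
import HarnessLib

/-!
# The free tube `(ℤ/L)² × Fin(M+1)²` as a charted finite volume of `ℤ⁴`

Helper file for stub `stub_tubeLimitState` of crux `FibreToTorus` (stmt-QuantumFields-16244),
line `uniqueness`, route `ContractibleFibre`.  The sites of the free tube of the crux are
`St = ZMod L × ZMod L × Fin (M+1) × Fin (M+1)` with forward neighbours `sh` (periodic in the two
long directions `0, 1`, and `+1` in `Fin (M+1)` in the two fibre directions `2, 3`, the wrapping
plaquettes being switched off by `ins`).  The chart `ψ : ℤ⁴ → St` reduces the long coordinates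
mod `L` and CENTRES the fibre coordinates, `x ↦ clamp(x + ⌊M/2⌋)`.  On the sites of sup-norm at
most `R` it is a good chart in the sense of `chart_action_split` (injective, intertwining the unit
steps, unique predecessors, all plaquettes switched on) as soon as `M ≥ 2R + 4` and `L ≥ 2R + 1`.
Pure `Fin`/`ZMod` arithmetic.
-/

noncomputable section

open Finset
open Literature.Probability.LatticeModels

namespace Summit.QuantumFields.YangMills.Theorems.FibreToTorus

/-- Reduction mod `L` is injective on integers of absolute value at most `R < L/2`. [folklore] -/
theorem int_eq_of_zmod_eq {L R : ℕ} (hL : 2 * R + 1 ≤ L) {a b : ℤ} (ha : a.natAbs ≤ R)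
    (hb : b.natAbs ≤ R) (h : ((a : ℤ) : ZMod L) = ((b : ℤ) : ZMod L)) : a = b := by
  rw [ZMod.intCast_eq_intCast_iff_dvd_sub] at h
  have h3 : |b - a| < (L : ℤ) := by
    rw [abs_lt]; omega
  have := Int.eq_zero_of_abs_lt_dvd h h3
  omega

/-- The centred fibre coordinate `z ↦ min (z + H).toNat M` in the translation regime
`2 ≤ z + H`, `z + H + 2 ≤ M`: its value is `z + H`, at most `M - 2`. [folklore] -/
theorem fibreCoord_val {M H : ℕ} {z : ℤ} (h1 : 2 ≤ z + H) (h2 : z + H + 2 ≤ M) :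
    ((min (z + H).toNat M : ℕ) : ℤ) = z + H ∧ min (z + H).toNat M + 2 ≤ M := by
  have hle : (z + H).toNat ≤ M := by omega
  rw [min_eq_left hle]
  omega

/-- **The free tube is a good chart of `ℤ⁴` on bounded sets.** For `M ≥ 2R + 4` and
`L ≥ 2R + 1`, on the sites of `ℤ⁴` of sup-norm at most `R` the tube chart
`ψ x = (x₀ mod L, x₁ mod L, clamp(x₂ + ⌊M/2⌋), clamp(x₃ + ⌊M/2⌋))` is injective, intertwines
the unit steps with the tube's forward-neighbour map `sh`, has unique `sh`-predecessors, and lands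
on sites all of whose plaquettes are switched on by the free-boundary indicator `ins`. [folklore] -/
theorem tubeChart_good (M L R : ℕ) [NeZero L] (B : Finset (Site 4))
    (hR : ∀ x ∈ B, ∀ i, (x i).natAbs ≤ R) (hM : 2 * R + 4 ≤ M) (hL : 2 * R + 1 ≤ L) :
    let sh : ZMod L × ZMod L × Fin (M + 1) × Fin (M + 1) → Fin 4 →
        ZMod L × ZMod L × Fin (M + 1) × Fin (M + 1) := fun x μ =>
      ![(x.1 + 1, x.2.1, x.2.2.1, x.2.2.2), (x.1, x.2.1 + 1, x.2.2.1, x.2.2.2),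
        (x.1, x.2.1, x.2.2.1 + 1, x.2.2.2), (x.1, x.2.1, x.2.2.1, x.2.2.2 + 1)] μ
    let ins : ZMod L × ZMod L × Fin (M + 1) × Fin (M + 1) → Fin 4 → Fin 4 → ℝ := fun x μ κ =>
      if ((μ = 2 ∨ κ = 2) → (x.2.2.1 : ℕ) < M) ∧ ((μ = 3 ∨ κ = 3) → (x.2.2.2 : ℕ) < M)
      then 1 else 0
    let fM : ℤ → Fin (M + 1) := fun z =>
      ⟨min (z + ((M / 2 : ℕ) : ℤ)).toNat M, Nat.lt_succ_of_le (min_le_right _ _)⟩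
    let ψ : Site 4 → ZMod L × ZMod L × Fin (M + 1) × Fin (M + 1) := fun x =>
      (((x 0 : ℤ) : ZMod L), ((x 1 : ℤ) : ZMod L), fM (x 2), fM (x 3))
    Set.InjOn ψ ↑B ∧ (∀ x ∈ B, ∀ μ : Fin 4, ψ (x + Pi.single μ 1) = sh (ψ x) μ) ∧
      (∀ x ∈ B, ∀ (μ : Fin 4) (z : ZMod L × ZMod L × Fin (M + 1) × Fin (M + 1)),
        sh z μ = ψ x → z = ψ (x - Pi.single μ 1)) ∧
      (∀ x ∈ B, ∀ μ κ : Fin 4, ins (ψ x) μ κ = 1) := by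
  intro sh ins fM ψ
  -- the translation regime of the fibre coordinates on `B`
  have hreg : ∀ x ∈ B, ∀ i : Fin 4, 2 ≤ x i + ((M / 2 : ℕ) : ℤ) ∧
      x i + ((M / 2 : ℕ) : ℤ) + 2 ≤ M := by
    intro x hx i
    have h := hR x hx i
    constructor <;> omega
  -- values of the fibre coordinate and of its shifts
  have hval : ∀ x ∈ B, ∀ i : Fin 4, ((fM (x i) : ℕ) : ℤ) = x i + ((M / 2 : ℕ) : ℤ) ∧
      (fM (x i) : ℕ) + 2 ≤ M := fun x hx i => fibreCoord_val (hreg x hx i).1 (hreg x hx i).2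
  have hsucc : ∀ x ∈ B, ∀ i : Fin 4, fM (x i + 1) = fM (x i) + 1 := by
    intro x hx i
    obtain ⟨h1, h2⟩ := hval x hx i
    have h3 : ((min (x i + 1 + ((M / 2 : ℕ) : ℤ)).toNat M : ℕ) : ℤ) =
        x i + 1 + ((M / 2 : ℕ) : ℤ) := by
      have := (hreg x hx i)
      rw [min_eq_left (by omega)]
      omega
    apply Fin.ext
    rw [Fin.val_add_one_of_lt (by rw [Fin.lt_def, Fin.val_last]; omega)]
    have h4 : ((fM (x i + 1) : ℕ) : ℤ) = x i + 1 + ((M / 2 : ℕ) : ℤ) := h3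
    omega
  have hpredv : ∀ x ∈ B, ∀ i : Fin 4,
      ((fM (x i - 1) : ℕ) : ℤ) = x i - 1 + ((M / 2 : ℕ) : ℤ) := by
    intro x hx i
    have := hreg x hx i
    show ((min (x i - 1 + ((M / 2 : ℕ) : ℤ)).toNat M : ℕ) : ℤ) = _
    rw [min_eq_left (by omega)]
    omega
  -- the fibre predecessor: `a + 1 = fM (x i)` in `Fin (M+1)` forces `a = fM (x i - 1)`
  have hpredFin : ∀ x ∈ B, ∀ (i : Fin 4) (a : Fin (M + 1)), a + 1 = fM (x i) →
      a = fM (x i - 1) := by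
    intro x hx i a ha
    apply Fin.ext
    have hv := (hval x hx i).1
    have hp := hpredv x hx i
    have ha' := congrArg Fin.val ha
    by_cases hlast : (a : ℕ) = M
    · exfalso
      have h0 : ((a + 1 : Fin (M + 1)) : ℕ) = 0 := by
        have : a = Fin.last M := Fin.ext (by simp [hlast])
        simp [this]
      omega
    · have h0 : ((a + 1 : Fin (M + 1)) : ℕ) = a + 1 :=
        Fin.val_add_one_of_lt (by rw [Fin.lt_def, Fin.val_last]; omega)
      omega
  refine ⟨?_, ?_, ?_, ?_⟩
  · -- injectivity
    intro x hx y hy hxy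
    simp only [ψ, Prod.mk.injEq] at hxy
    obtain ⟨h0, h1, h2, h3⟩ := hxy
    have e0 : x 0 = y 0 := int_eq_of_zmod_eq hL (hR x hx 0) (hR y hy 0) h0
    have e1 : x 1 = y 1 := int_eq_of_zmod_eq hL (hR x hx 1) (hR y hy 1) h1
    have e2 : x 2 = y 2 := by
      have a := (hval x hx 2).1; have b := (hval y hy 2).1
      have : ((fM (x 2) : ℕ) : ℤ) = ((fM (y 2) : ℕ) : ℤ) := by rw [h2]
      omega
    have e3 : x 3 = y 3 := by
      have a := (hval x hx 3).1; have b := (hval y hy 3).1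
      have : ((fM (x 3) : ℕ) : ℤ) = ((fM (y 3) : ℕ) : ℤ) := by rw [h3]
      omega
    funext i
    fin_cases i <;> assumption
  · -- unit steps
    intro x hx μ
    fin_cases μ <;>
      simp [ψ, sh, Pi.add_apply, hsucc x hx, Int.cast_add, Int.cast_one]
  · -- unique predecessors
    intro x hx μ z h
    fin_cases μ
    · simp only [sh, ψ, Fin.zero_eta, Matrix.cons_val_zero, Prod.mk.injEq] at h
      obtain ⟨h0, h1, h2, h3⟩ := h
      simp only [ψ, Fin.zero_eta, Pi.sub_apply, Pi.single_apply]
      refine Prod.ext ?_ (Prod.ext ?_ (Prod.ext ?_ ?_)) <;> simp_all [eq_sub_iff_add_eq]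
    · simp only [sh, ψ, Fin.mk_one, Matrix.cons_val_one, Matrix.cons_val_zero,
        Prod.mk.injEq] at h
      obtain ⟨h0, h1, h2, h3⟩ := h
      simp only [ψ, Fin.mk_one, Pi.sub_apply, Pi.single_apply]
      refine Prod.ext ?_ (Prod.ext ?_ (Prod.ext ?_ ?_)) <;> simp_all [eq_sub_iff_add_eq]
    · simp only [sh, ψ, Fin.reduceFinMk, Matrix.cons_val, Prod.mk.injEq] at h
      obtain ⟨h0, h1, h2, h3⟩ := h
      have hz : z.2.2.1 = fM (x 2 - 1) := hpredFin x hx 2 _ h2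
      simp only [ψ, Fin.reduceFinMk, Pi.sub_apply, Pi.single_apply]
      refine Prod.ext ?_ (Prod.ext ?_ (Prod.ext ?_ ?_)) <;> simp_all
    · simp only [sh, ψ, Fin.reduceFinMk, Matrix.cons_val, Prod.mk.injEq] at h
      obtain ⟨h0, h1, h2, h3⟩ := h
      have hz : z.2.2.2 = fM (x 3 - 1) := hpredFin x hx 3 _ h3
      simp only [ψ, Fin.reduceFinMk, Pi.sub_apply, Pi.single_apply]
      refine Prod.ext ?_ (Prod.ext ?_ (Prod.ext ?_ ?_)) <;> simp_all
  · -- all plaquettes on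
    intro x hx μ κ
    have h2 := (hval x hx 2).2
    have h3 := (hval x hx 3).2
    simp only [ins, ψ]
    rw [if_pos]
    constructor <;> intro _ <;> omega

/-- **Registered form (sub-goal `tubeLimit_tubeChart` of `stub_tubeLimitState`)** of
`tubeChart_good`: closed statement. [folklore] -/
theorem tubeLimit_tubeChart : ∀ (M L R : ℕ) [NeZero L] (B : Finset (Site 4)), (∀ x ∈ B, ∀ i, (x i).natAbs ≤ R) → 2 * R + 4 ≤ M → 2 * R + 1 ≤ L → let sh : ZMod L × ZMod L × Fin (M + 1) × Fin (M + 1) → Fin 4 → ZMod L × ZMod L × Fin (M + 1) × Fin (M + 1) := fun x μ => ![(x.1 + 1, x.2.1, x.2.2.1, x.2.2.2), (x.1, x.2.1 + 1, x.2.2.1, x.2.2.2), (x.1, x.2.1, x.2.2.1 + 1, x.2.2.2), (x.1, x.2.1, x.2.2.1, x.2.2.2 + 1)] μ; let ins : ZMod L × ZMod L × Fin (M + 1) × Fin (M + 1) → Fin 4 → Fin 4 → ℝ := fun x μ κ => if ((μ = 2 ∨ κ = 2) → (x.2.2.1 : ℕ) < M) ∧ ((μ = 3 ∨ κ = 3)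 → (x.2.2.2 : ℕ) < M) then 1 else 0; let fM : ℤ → Fin (M + 1) := fun z => ⟨min (z + ((M / 2 : ℕ) : ℤ)).toNat M, Nat.lt_succ_of_le (min_le_right _ _)⟩; let ψ : Site 4 → ZMod L × ZMod L × Fin (M + 1) × Fin (M + 1) := fun x => (((x 0 : ℤ) : ZMod L), ((x 1 : ℤ) : ZMod L), fM (x 2), fM (x 3)); Set.InjOn ψ ↑B ∧ (∀ x ∈ B, ∀ μ : Fin 4, ψ (x + Pi.single μ 1) = sh (ψ x) μ) ∧ (∀ x ∈ B, ∀ (μ : Fin 4) (z : ZMod L × ZMod L × Fin (M + 1) × Fin (M + 1)), sh z μ = ψ x → z = ψ (x - Pi.single μ 1)) ∧ (∀ x ∈ B, ∀ μ κ : Fin 4, ins (ψ x) μ κ = 1) :=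
  fun M L R _ B hR hM hL => tubeChart_good M L R B hR hM hL

end Summit.QuantumFields.YangMills.Theorems.FibreToTorus

end
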